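import Summits.CriticalPhenomena.PercolationContinuityZ3.Theorems.PercNearOneGluingNoHeavyLowerTailSahiIndependentProducts
import Summits.CriticalPhenomena.PercolationContinuityZ3.Theorems.PercNearOneGluingNoHeavyLowerTailSahiHittingJoinAbsorption
import Literature.Combinatorics.Sahi2008.Symmetry
import HarnessLib

/-!
# `NoHeavyLowerTail` (stmt-CriticalPhenomena-4575) — a positively correlated PAIR of events joins independently, at EVERY order,
# to any hereditarily Sahi-positive class; hitting events: `H_A, H_B` (arbitrary) ∪ a width-≤5 hitting family on disjoint coordinates

Support file, seat `prim-l12-p5` (gen 13), `--supports stmt-CriticalPhenomena-4575`; COMPUTATIONAL only through the imported hitting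
`C₄/C₅` kernel certificates used by `…SahiHittingWidthFive` (the abstract Part 1–2 use standard axioms).  No definitions, no named facts,
no sorries.

## What is proved

Two ingredients of the tree are combined:
* the INDEPENDENT PRODUCT FORMULA and its corollary "independent products preserve Sahi positivity of a multiplicatively closed
  class" (`SahiIndependentProducts.sahiE_prodWeight_nonneg_of_classes`, seat prim-sahi-p2), and
* SAHI'S PROPOSITION 15 IN EVENT FORM (`Literature.Combinatorics.Sahi2008.sahiE_nonneg_of_corrPair_labels`): for ANY probability
  weight and two `{0,1}`-valued functions `g₁, g₂` with `E g₁ · E g₂ ≤ E(g₁g₂)`, every family drawn from `{g₁, g₂, g₁g₂}` has `E_n ≥ 0`.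
Since `{1, g₁, g₂, g₁g₂}` (all products `g₁^a g₂^b`) is multiplicatively closed, we get:

* `sahiE_nonneg_of_forall_mem_insert_one` — padding a hereditarily Sahi-positive class with the constant `1` keeps it hereditarily
  positive (branching [Sahi2008, Thm. 6] + symmetry);
* `sahiE_nonneg_of_powClass` — every family of products `g₁^a g₂^b` of a positively correlated pair of events is Sahi-nonnegative
  at every order (Prop. 15 event form + idempotence + padding);
* **`sahiE_prodWeight_nonneg_of_corrPair_of_class`** (main, abstract): `μ` a probability weight on `α` with a positively correlated
  pair of events `g₁, g₂`; `ν` a probability weight on `β` and `ℬ` a class of functions on `β` all of whose finite families are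
  Sahi-nonnegative.  Then under `μ ⊗ ν` every family of products `φ_i(x)ψ_i(y)` with `φ_i ∈ {g₁^a g₂^b}` and `ψ_i ∈ ℬ ∪ {1}` has
  `E_n ≥ 0` — in particular the UNION family (`g₁, g₂` on the first factor, a `ℬ`-family on the second).  No monotonicity and no
  FKG hypothesis on `μ` is needed: positive correlation of ONE pair suffices on the first factor.
* **Hitting events** (`SahiHitting` vocabulary: `bernoulliWeight p`, `ind {ω | ∃ a ∈ A, a ∈ ω}`): two hitting events are positively
  correlated (`ex_hit_mul_ex_hit_le`, from `cov_hit_eq`), and hitting families of width ≤ 5 are Sahi-nonnegative at every order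
  (`prodBernoulli_sahiE_hit_nonneg_of_width_le_five`, gen 12).  Hence (`bernoulliWeight_sahiE_hitPair_prod_nonneg`,
  `bernoulliWeight_sahiE_hitPair_union_nonneg`, `…_of_card_le_five`): for two independent product-Bernoulli models on `ι₁`, `ι₂`,
  ARBITRARY `A, B ⊆ ι₁` and any collection `C_k ⊆ ι₂` of width ≤ 5 (among any six of them two are nested), every family built from
  `H_A, H_B, H_A ∩ H_B` on the first factor and the `H_{C_k}` on the second (also slots `H_A ∩ H_{C_k}` etc.) is Sahi-nonnegative at
  EVERY order.  These families reach width 7 (`A, B` incomparable plus an antichain of five `C_k`), beyond `…SahiHittingWidthFive`.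
-/

namespace Summit.CriticalPhenomena.PercolationContinuityZ3.Theorems

namespace SahiIndependentPairJoin

open Finset Function Literature.Combinatorics.Sahi2008
open Literature.Probability.Percolation.DecisionTree (ind ind_of_mem ind_of_not_mem ind_nonneg)

/-! ## Part 1.  Padding a hereditarily positive class with the constant `1` -/

section Padding

variable {β : Type*} [Fintype β]

/-- **Padding with `1`.**  If every finite family drawn from a class `ℬ` is Sahi-nonnegative under a weight of total mass `1`, then
so is every finite family drawn from `ℬ ∪ {1}`: a slot equal to `1` is moved to the front (symmetry of `E_n`) and peeled by branching,
`E_{k+2}(1, g) = k·E_{k+1}(g)`. [cite: Sahi2008, Thm. 6 (p. 214); LiebSahi2021, eq. (1.3)] -/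
theorem sahiE_nonneg_of_forall_mem_insert_one (ν : β → ℝ) (hν : ∑ y, ν y = 1) (ℬ : Set (β → ℝ))
    (hℬ : ∀ (m : ℕ) (g : Fin m → β → ℝ), (∀ j, g j ∈ ℬ) → 0 ≤ sahiE ν m g) :
    ∀ (m : ℕ) (g : Fin m → β → ℝ), (∀ j, g j ∈ insert (1 : β → ℝ) ℬ) → 0 ≤ sahiE ν m g := by
  intro m
  induction m with
  | zero => intro g _; rw [sahiE_zero]
  | succ k ih =>
    intro g hg
    by_cases h1 : ∃ j, g j = 1
    · obtain ⟨j, hj⟩ := h1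
      rw [← sahiE_comp_perm ν (k + 1) (Equiv.swap 0 j) g]
      have h0 : (fun i => g (Equiv.swap 0 j i)) 0 = 1 := by
        simp only [Equiv.swap_apply_left, hj]
      cases k with
      | zero =>
        have h0' : g (Equiv.swap 0 j 0) = 1 := by rw [Equiv.swap_apply_left]; exact hj
        rw [sahiE_one_apply]
        show 0 ≤ ex ν (g (Equiv.swap 0 j 0))
        rw [h0', ex_one hν]
        exact zero_le_one
      | succ k' =>
        rw [sahiE_succ_succ_of_head_eq_one hν _ h0]
        exact mul_nonneg (Nat.cast_nonneg _) (ih _ fun i => hg _)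
    · push Not at h1
      refine hℬ _ g fun j => ?_
      rcases Set.mem_insert_iff.1 (hg j) with h | h
      · exact absurd h (h1 j)
      · exact h

end Padding

/-! ## Part 2.  A positively correlated pair of events: the class `{g₁^a g₂^b}` -/

section Pair

variable {α : Type*} [Fintype α]

omit [Fintype α] in
/-- An idempotent function equals all its positive powers (plumbing). [folklore] -/
theorem pow_succ_eq_of_mul_self {g : α → ℝ} (hg : g * g = g) : ∀ a : ℕ, g ^ (a + 1) = g
  | 0 => pow_one g
  | a + 1 => by rw [pow_succ, pow_succ_eq_of_mul_self hg a, hg]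

omit [Fintype α] in
/-- A `{0,1}`-valued function is idempotent (plumbing). [folklore] -/
theorem mul_self_of_zero_or_one {g : α → ℝ} (h : ∀ x, g x = 0 ∨ g x = 1) : g * g = g := by
  funext x
  rcases h x with hx | hx <;> simp [hx]

/-- **Sahi's Proposition 15 (event form), family version.**  For a probability weight and `{0,1}`-valued `g₁, g₂` with
`E g₁ E g₂ ≤ E(g₁g₂)`, every family whose slots are `g₁`, `g₂` or `g₁g₂` is Sahi-nonnegative at every order (the tree's labelled form
`sahiE_nonneg_of_corrPair_labels`, with the labels chosen). [cite: Sahi2008, Prop. 15 (p. 222), Lemma 16 (p. 223)] -/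
theorem sahiE_nonneg_of_mem_corrPair (μ : α → ℝ) (hμ0 : ∀ x, 0 ≤ μ x) (hμ1 : ∑ x, μ x = 1) (g₁ g₂ : α → ℝ)
    (h₁ : ∀ x, g₁ x = 0 ∨ g₁ x = 1) (h₂ : ∀ x, g₂ x = 0 ∨ g₂ x = 1) (hcorr : ex μ g₁ * ex μ g₂ ≤ ex μ (g₁ * g₂))
    {m : ℕ} (f : Fin m → α → ℝ) (hf : ∀ j, f j = g₁ ∨ f j = g₂ ∨ f j = g₁ * g₂) : 0 ≤ sahiE μ m f := by
  have hl : ∀ j, ∃ l : Fin 3, f j = (![g₁, g₂, g₁ * g₂] : Fin 3 → α → ℝ) l := by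
    intro j
    rcases hf j with h | h | h
    · exact ⟨0, by rw [h]; rfl⟩
    · exact ⟨1, by rw [h]; rfl⟩
    · exact ⟨2, by rw [h]; rfl⟩
  choose lab hlab using hl
  have hf' : f = fun j => (![g₁, g₂, g₁ * g₂] : Fin 3 → α → ℝ) (lab j) := funext hlab
  rw [hf']
  exact sahiE_nonneg_of_corrPair_labels μ hμ0 hμ1 g₁ g₂ h₁ h₂ hcorr lab

/-- **Every family of products `g₁^a g₂^b` of a positively correlated pair of events is Sahi-nonnegative at every order**
(probability weight, no monotonicity): such a product is `1`, `g₁`, `g₂` or `g₁g₂` by idempotence; then Prop. 15 (event form)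
and padding with `1`. [cite: Sahi2008, Prop. 15 (p. 222), Thm. 6 (p. 214)] -/
theorem sahiE_nonneg_of_powClass (μ : α → ℝ) (hμ0 : ∀ x, 0 ≤ μ x) (hμ1 : ∑ x, μ x = 1) (g₁ g₂ : α → ℝ)
    (h₁ : ∀ x, g₁ x = 0 ∨ g₁ x = 1) (h₂ : ∀ x, g₂ x = 0 ∨ g₂ x = 1) (hcorr : ex μ g₁ * ex μ g₂ ≤ ex μ (g₁ * g₂))
    {m : ℕ} (f : Fin m → α → ℝ) (hf : ∀ j, ∃ a b : ℕ, f j = g₁ ^ a * g₂ ^ b) : 0 ≤ sahiE μ m f := by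
  have hid₁ : g₁ * g₁ = g₁ := mul_self_of_zero_or_one h₁
  have hid₂ : g₂ * g₂ = g₂ := mul_self_of_zero_or_one h₂
  refine sahiE_nonneg_of_forall_mem_insert_one μ hμ1 {f | f = g₁ ∨ f = g₂ ∨ f = g₁ * g₂}
    (fun m g hg => sahiE_nonneg_of_mem_corrPair μ hμ0 hμ1 g₁ g₂ h₁ h₂ hcorr g hg) m f fun j => ?_
  obtain ⟨a, b, hab⟩ := hf j
  rw [Set.mem_insert_iff, Set.mem_setOf_eq, hab]
  rcases a with _ | a <;> rcases b with _ | b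
  · left; rw [pow_zero, pow_zero, one_mul]
  · right; right; left; rw [pow_zero, one_mul, pow_succ_eq_of_mul_self hid₂]
  · right; left; rw [pow_zero, mul_one, pow_succ_eq_of_mul_self hid₁]
  · right; right; right; rw [pow_succ_eq_of_mul_self hid₁, pow_succ_eq_of_mul_self hid₂]

end Pair

/-! ## Part 3.  The abstract join theorem -/

section Join

variable {α β : Type*} [Fintype α] [Fintype β]

/-- **A positively correlated pair of events joins independently to any hereditarily Sahi-positive class, at every order.**
`μ` a probability weight on `α`, `g₁, g₂ : α → {0,1}` with `E g₁ E g₂ ≤ E(g₁g₂)`; `ν` a probability weight on `β`, `ℬ` a class of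
functions on `β` all of whose finite families have `E_m ≥ 0`.  Then under the product weight `μ ⊗ ν` every family of products
`φ_i(x)ψ_i(y)` with `φ_i = g₁^{a_i} g₂^{b_i}` and `ψ_i ∈ ℬ ∪ {1}` has `E_n ≥ 0`.  (Independent product formula for the
multiplicatively closed class `{g₁^a g₂^b}` and the padded class `ℬ ∪ {1}`.)
[cite: Sahi2008, Prop. 12 (p. 219), Prop. 15 (p. 222), Conj. 5 (p. 212)] -/
theorem sahiE_prodWeight_nonneg_of_corrPair_of_class (μ : α → ℝ) (ν : β → ℝ) (hμ0 : ∀ x, 0 ≤ μ x)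
    (hμ1 : ∑ x, μ x = 1) (hν1 : ∑ y, ν y = 1) (g₁ g₂ : α → ℝ) (h₁ : ∀ x, g₁ x = 0 ∨ g₁ x = 1)
    (h₂ : ∀ x, g₂ x = 0 ∨ g₂ x = 1) (hcorr : ex μ g₁ * ex μ g₂ ≤ ex μ (g₁ * g₂)) (ℬ : Set (β → ℝ))
    (hℬ : ∀ (m : ℕ) (g : Fin m → β → ℝ), (∀ j, g j ∈ ℬ) → 0 ≤ sahiE ν m g)
    {n : ℕ} (φ : Fin n → α → ℝ) (ψ : Fin n → β → ℝ) (hφ : ∀ i, ∃ a b : ℕ, φ i = g₁ ^ a * g₂ ^ b)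
    (hψ : ∀ i, ψ i ∈ insert (1 : β → ℝ) ℬ) :
    0 ≤ sahiE (fun q : α × β => μ q.1 * ν q.2) n (fun i q => φ i q.1 * ψ i q.2) :=
  SahiIndependentProducts.sahiE_prodWeight_nonneg_of_classes μ ν hμ1 hν1 {f | ∃ a b : ℕ, f = g₁ ^ a * g₂ ^ b}
    (insert (1 : β → ℝ) ℬ) ⟨0, 0, by rw [pow_zero, pow_zero, one_mul]⟩
    (fun f ⟨a, b, hf⟩ f' ⟨a', b', hf'⟩ => ⟨a + a', b + b', by rw [hf, hf', pow_add, pow_add]; ring⟩)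
    (fun m f hf => sahiE_nonneg_of_powClass μ hμ0 hμ1 g₁ g₂ h₁ h₂ hcorr f hf)
    (sahiE_nonneg_of_forall_mem_insert_one ν hν1 ℬ hℬ) φ ψ hφ hψ

/-- **Union form.**  With the data of `sahiE_prodWeight_nonneg_of_corrPair_of_class`: the family consisting of `g₁, g₂` (read on
the first factor) and any `ℬ`-family `g_0, …, g_{m−1}` (read on the second factor) has `E_{m+2} ≥ 0` under `μ ⊗ ν`.
[cite: Sahi2008, Prop. 12 (p. 219), Prop. 15 (p. 222), Conj. 5 (p. 212)] -/
theorem sahiE_prodWeight_corrPair_union_nonneg (μ : α → ℝ) (ν : β → ℝ) (hμ0 : ∀ x, 0 ≤ μ x)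
    (hμ1 : ∑ x, μ x = 1) (hν1 : ∑ y, ν y = 1) (g₁ g₂ : α → ℝ) (h₁ : ∀ x, g₁ x = 0 ∨ g₁ x = 1)
    (h₂ : ∀ x, g₂ x = 0 ∨ g₂ x = 1) (hcorr : ex μ g₁ * ex μ g₂ ≤ ex μ (g₁ * g₂)) (ℬ : Set (β → ℝ))
    (hℬ : ∀ (m : ℕ) (g : Fin m → β → ℝ), (∀ j, g j ∈ ℬ) → 0 ≤ sahiE ν m g)
    {m : ℕ} (g : Fin m → β → ℝ) (hg : ∀ j, g j ∈ ℬ) :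
    0 ≤ sahiE (fun q : α × β => μ q.1 * ν q.2) (m + 2)
      (Fin.cons (fun q => g₁ q.1) (Fin.cons (fun q => g₂ q.1) (fun j q => g j q.2))) := by
  have key := sahiE_prodWeight_nonneg_of_corrPair_of_class μ ν hμ0 hμ1 hν1 g₁ g₂ h₁ h₂ hcorr ℬ hℬ
    (Fin.cons g₁ (Fin.cons g₂ (fun _ => 1)) : Fin (m + 2) → α → ℝ)
    (Fin.cons 1 (Fin.cons 1 g) : Fin (m + 2) → β → ℝ)
    (fun i => by
      refine Fin.cases ⟨1, 0, ?_⟩ (fun i' => Fin.cases ⟨0, 1, ?_⟩ (fun j => ⟨0, 0, ?_⟩) i') i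
      · simp only [Fin.cons_zero, pow_one, pow_zero, mul_one]
      · simp only [Fin.cons_succ, Fin.cons_zero, pow_one, pow_zero, one_mul]
      · simp only [Fin.cons_succ, pow_zero, one_mul])
    (fun i => by
      refine Fin.cases ?_ (fun i' => Fin.cases ?_ (fun j => ?_) i') i
      · simp only [Fin.cons_zero]; exact Set.mem_insert _ _
      · simp only [Fin.cons_succ, Fin.cons_zero]; exact Set.mem_insert _ _
      · simp only [Fin.cons_succ]; exact Set.mem_insert_of_mem _ (hg j))
  have hfam : (Fin.cons (fun q : α × β => g₁ q.1) (Fin.cons (fun q => g₂ q.1) (fun j q => g j q.2)) :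
      Fin (m + 2) → α × β → ℝ) =
      fun i q => (Fin.cons g₁ (Fin.cons g₂ (fun _ => 1)) : Fin (m + 2) → α → ℝ) i q.1 *
        (Fin.cons 1 (Fin.cons 1 g) : Fin (m + 2) → β → ℝ) i q.2 := by
    funext i q
    refine Fin.cases ?_ (fun i' => Fin.cases ?_ (fun j => ?_) i') i
    · simp only [Fin.cons_zero, Pi.one_apply, mul_one]
    · simp only [Fin.cons_succ, Fin.cons_zero, Pi.one_apply, mul_one]
    · simp only [Fin.cons_succ, Pi.one_apply, one_mul]
  rw [hfam]
  exact key

end Join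

/-! ## Part 4.  Hitting events of two independent product-Bernoulli models -/

section Hitting

open SahiHitting

variable {ι₁ ι₂ : Type*} [Fintype ι₁] [DecidableEq ι₁] [Fintype ι₂] [DecidableEq ι₂]

omit [Fintype ι₁] [DecidableEq ι₁] in
/-- An indicator function is `{0,1}`-valued (plumbing). [folklore] -/
theorem ind_zero_or_one (X : Set (Set ι₁)) (ω : Set ι₁) : ind X ω = 0 ∨ ind X ω = 1 := by
  by_cases h : ω ∈ X
  · exact Or.inr (ind_of_mem h)
  · exact Or.inl (ind_of_not_mem h)

/-- **Two hitting events are positively correlated** (Harris for this pair, from the closed form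
`Cov(H_A,H_B) = Π_{A∪B} q − Π_A q Π_B q ≥ 0`, `q = 1 − p ∈ [0,1]`). [cite: Sahi2008, eq. (2) (p. 210); Harris 1960] -/
theorem ex_hit_mul_ex_hit_le (p : ι₁ → unitInterval) (A B : Finset ι₁) :
    ex (bernoulliWeight p) (ind {ω : Set ι₁ | ∃ a ∈ A, a ∈ ω}) * ex (bernoulliWeight p) (ind {ω : Set ι₁ | ∃ a ∈ B, a ∈ ω}) ≤
      ex (bernoulliWeight p) (ind {ω : Set ι₁ | ∃ a ∈ A, a ∈ ω} * ind {ω : Set ι₁ | ∃ a ∈ B, a ∈ ω}) := by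
  rw [← sub_nonneg, cov_hit_eq, sub_nonneg]
  have hq0 : ∀ c, 0 ≤ 1 - (p c : ℝ) := fun c => sub_nonneg.2 (p c).2.2
  have hq1 : ∀ c, 1 - (p c : ℝ) ≤ 1 := fun c => sub_le_self _ (p c).2.1
  have hB : ∏ c ∈ B, (1 - (p c : ℝ)) ≤ ∏ c ∈ B \ A, (1 - (p c : ℝ)) :=
    Finset.prod_le_prod_of_subset_of_le_one Finset.sdiff_subset (fun c _ => hq0 c) (fun c _ _ => hq1 c)
  calc (∏ c ∈ A, (1 - (p c : ℝ))) * ∏ c ∈ B, (1 - (p c : ℝ))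
      ≤ (∏ c ∈ A, (1 - (p c : ℝ))) * ∏ c ∈ B \ A, (1 - (p c : ℝ)) :=
        mul_le_mul_of_nonneg_left hB (Finset.prod_nonneg fun c _ => hq0 c)
    _ = ∏ c ∈ A ∪ B, (1 - (p c : ℝ)) := by
        rw [← Finset.prod_union Finset.disjoint_sdiff, Finset.union_sdiff_self_eq_union]

omit [Fintype ι₂] [DecidableEq ι₂] in
/-- Width ≤ 5 of a collection of sets is inherited by every family drawn from it (with repetitions: equal sets count as nested).
[folklore] -/
theorem width_pullback {κ : Type*} (C : κ → Finset ι₂)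
    (hC : ∀ T : Finset κ, T.card = 6 → ∃ a ∈ T, ∃ b ∈ T, a ≠ b ∧ C a ⊆ C b) {m : ℕ} (k : Fin m → κ)
    (S : Finset (Fin m)) (hS : S.card = 6) : ∃ i ∈ S, ∃ j ∈ S, i ≠ j ∧ C (k i) ⊆ C (k j) := by
  classical
  by_cases hinj : Set.InjOn k S
  · have hT : (S.image k).card = 6 := by rw [Finset.card_image_of_injOn hinj, hS]
    obtain ⟨a, ha, b, hb, hab, hsub⟩ := hC (S.image k) hT
    obtain ⟨i, hi, rfl⟩ := Finset.mem_image.1 ha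
    obtain ⟨j, hj, rfl⟩ := Finset.mem_image.1 hb
    exact ⟨i, hi, j, hj, fun h => hab (by rw [h]), hsub⟩
  · simp only [Set.InjOn, not_forall] at hinj
    obtain ⟨i, hi, j, hj, hk, hij⟩ := hinj
    exact ⟨i, hi, j, hj, hij, by rw [hk]⟩

/-- The class of hitting indicators of a width-≤5 collection is hereditarily Sahi-nonnegative at every order under a product weight
(gen 12's `prodBernoulli_sahiE_hit_nonneg_of_width_le_five`, pulled back). [this work] -/
theorem sahiE_nonneg_of_mem_hitClass (p : ι₂ → unitInterval) {κ : Type*} (C : κ → Finset ι₂)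
    (hC : ∀ T : Finset κ, T.card = 6 → ∃ a ∈ T, ∃ b ∈ T, a ≠ b ∧ C a ⊆ C b) (m : ℕ) (g : Fin m → Set ι₂ → ℝ)
    (hg : ∀ j, g j ∈ Set.range fun k => ind {ω : Set ι₂ | ∃ a ∈ C k, a ∈ ω}) :
    0 ≤ sahiE (bernoulliWeight p) m g := by
  choose k hk using hg
  have hg' : g = fun j => ind {ω : Set ι₂ | ∃ a ∈ C (k j), a ∈ ω} := funext fun j => (hk j).symm
  rw [hg']
  exact prodBernoulli_sahiE_hit_nonneg_of_width_le_five p m (fun j => C (k j)) fun S hS => width_pullback C hC k S hS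

/-- **Hitting events of two independent percolation models, product form, every order.**  Product-Bernoulli weights `p₁` on `ι₁` and
`p₂` on `ι₂`; ARBITRARY `A, B ⊆ ι₁`; a collection `C_k ⊆ ι₂` of width ≤ 5 (among any six, two nested).  Under the product of the two
models, every family whose slot `i` is `(H_A)^{a_i}(H_B)^{b_i}` on the first factor times `1` or some `H_{C_k}` on the second factor
(so: `H_A, H_B, H_A∩H_B, H_{C_k}, H_A∩H_{C_k}, …`) has `E_n ≥ 0`. [this work] -/
theorem bernoulliWeight_sahiE_hitPair_prod_nonneg (p₁ : ι₁ → unitInterval) (p₂ : ι₂ → unitInterval) (A B : Finset ι₁)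
    {κ : Type*} (C : κ → Finset ι₂) (hC : ∀ T : Finset κ, T.card = 6 → ∃ a ∈ T, ∃ b ∈ T, a ≠ b ∧ C a ⊆ C b)
    {n : ℕ} (φ : Fin n → Set ι₁ → ℝ)
    (hφ : ∀ i, ∃ a b : ℕ, φ i = ind {ω : Set ι₁ | ∃ a ∈ A, a ∈ ω} ^ a * ind {ω : Set ι₁ | ∃ a ∈ B, a ∈ ω} ^ b)
    (ψ : Fin n → Set ι₂ → ℝ) (hψ : ∀ i, ψ i = 1 ∨ ∃ k, ψ i = ind {ω : Set ι₂ | ∃ a ∈ C k, a ∈ ω}) :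
    0 ≤ sahiE (fun q : Set ι₁ × Set ι₂ => bernoulliWeight p₁ q.1 * bernoulliWeight p₂ q.2) n
      (fun i q => φ i q.1 * ψ i q.2) := by
  refine sahiE_prodWeight_nonneg_of_corrPair_of_class (bernoulliWeight p₁) (bernoulliWeight p₂)
    (isFKGMeasure_bernoulliWeight p₁).nonneg (sum_bernoulliWeight p₁) (sum_bernoulliWeight p₂) _ _
    (ind_zero_or_one _) (ind_zero_or_one _) (ex_hit_mul_ex_hit_le p₁ A B)
    (Set.range fun k => ind {ω : Set ι₂ | ∃ a ∈ C k, a ∈ ω}) (sahiE_nonneg_of_mem_hitClass p₂ C hC) φ ψ hφ fun i => ?_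
  rcases hψ i with h | ⟨k, hk⟩
  · rw [h]; exact Set.mem_insert _ _
  · rw [hk]; exact Set.mem_insert_of_mem _ ⟨k, rfl⟩

/-- **Hitting events of two independent percolation models, union form, every order.**  For ARBITRARY `A, B ⊆ ι₁` and sets
`C (k 0), …, C (k (m−1)) ⊆ ι₂` drawn from a width-≤5 collection, the family `H_A, H_B, H_{C(k 0)}, …, H_{C(k (m−1))}` (the first two read
on the first factor, the others on the second) has `E_{m+2} ≥ 0` under the product of the two product-Bernoulli models.  Such families
have width up to `7`. [this work] -/
theorem bernoulliWeight_sahiE_hitPair_union_nonneg (p₁ : ι₁ → unitInterval) (p₂ : ι₂ → unitInterval) (A B : Finset ι₁)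
    {κ : Type*} (C : κ → Finset ι₂) (hC : ∀ T : Finset κ, T.card = 6 → ∃ a ∈ T, ∃ b ∈ T, a ≠ b ∧ C a ⊆ C b)
    {m : ℕ} (k : Fin m → κ) :
    0 ≤ sahiE (fun q : Set ι₁ × Set ι₂ => bernoulliWeight p₁ q.1 * bernoulliWeight p₂ q.2) (m + 2)
      (Fin.cons (fun q => ind {ω : Set ι₁ | ∃ a ∈ A, a ∈ ω} q.1)
        (Fin.cons (fun q => ind {ω : Set ι₁ | ∃ a ∈ B, a ∈ ω} q.1)
          (fun j q => ind {ω : Set ι₂ | ∃ a ∈ C (k j), a ∈ ω} q.2))) :=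
  sahiE_prodWeight_corrPair_union_nonneg (bernoulliWeight p₁) (bernoulliWeight p₂)
    (isFKGMeasure_bernoulliWeight p₁).nonneg (sum_bernoulliWeight p₁) (sum_bernoulliWeight p₂) _ _
    (ind_zero_or_one _) (ind_zero_or_one _) (ex_hit_mul_ex_hit_le p₁ A B)
    (Set.range fun k => ind {ω : Set ι₂ | ∃ a ∈ C k, a ∈ ω}) (sahiE_nonneg_of_mem_hitClass p₂ C hC)
    (fun j => ind {ω : Set ι₂ | ∃ a ∈ C (k j), a ∈ ω}) fun j => ⟨k j, rfl⟩

/-- **At most five sets on the second factor, arbitrary multiplicities.**  `A, B ⊆ ι₁` arbitrary, `C : Fin 5 → Finset ι₂` (or any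
index type with at most five elements) and any assignment `k` of the last `m` slots: `E_{m+2}(H_A, H_B, H_{C(k 0)}, …) ≥ 0` under the
product of the two models. [this work] -/
theorem bernoulliWeight_sahiE_hitPair_union_nonneg_of_card_le_five (p₁ : ι₁ → unitInterval) (p₂ : ι₂ → unitInterval)
    (A B : Finset ι₁) {κ : Type*} [Fintype κ] (hκ : Fintype.card κ ≤ 5) (C : κ → Finset ι₂) {m : ℕ} (k : Fin m → κ) :
    0 ≤ sahiE (fun q : Set ι₁ × Set ι₂ => bernoulliWeight p₁ q.1 * bernoulliWeight p₂ q.2) (m + 2)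
      (Fin.cons (fun q => ind {ω : Set ι₁ | ∃ a ∈ A, a ∈ ω} q.1)
        (Fin.cons (fun q => ind {ω : Set ι₁ | ∃ a ∈ B, a ∈ ω} q.1)
          (fun j q => ind {ω : Set ι₂ | ∃ a ∈ C (k j), a ∈ ω} q.2))) := by
  refine bernoulliWeight_sahiE_hitPair_union_nonneg p₁ p₂ A B C (fun T hT => ?_) k
  have : T.card ≤ Fintype.card κ := Finset.card_le_univ T
  omega

end Hitting

end SahiIndependentPairJoin

end Summit.CriticalPhenomena.PercolationContinuityZ3.Theorems
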